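import Literature.AnabelianGeometry.EtaleTheta.Discharge.Sec5Thm510
import Literature.AnabelianGeometry.EtaleTheta.FrobenioidRootTransport

/-!
# [EtTh] §5: Theorem 5.10 (ii)/(iii) from Theorem 5.7 BY NAME and the bundled §5 facts (pp. 329–335 / PDF pp. 103–109)

Mochizuki, *The étale theta function …*, Publ. RIMS **45** (2009)
[cite: MochizukiEtTh2009, Thm 5.10 (ii) p.333–335 (PDF pp.107–109)].  Seat abc-iut-L2-t4 (owner of the §5
statements); PROOF-ONLY bridge over abc-iut-L2-d4's discharge files `Discharge/Sec5Thm510ii.lean`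
(`psiAutPreserves_of`) and `Discharge/Sec5Thm510.lean` (`thm510_ii_iii_of_inputs`).

What this file adds (no new statement, no new hypothesis): the printed citation edge
**Theorem 5.7 ⟶ Theorem 5.10 (ii)** ("`Ψ` preserves `N`-th roots of fraction pairs … for … `l`-th roots of the
theta function [i.e., up to the indeterminacies discussed in the statement of Theorem 5.7]", proof of
Thm. 5.10 (ii), pp.334–335 (PDF pp.108–109)) made kernel-visible BY NAME — abc-iut-L2-d4's theorems take the
root-transport clauses `hT`, `hT'`, `hind` unbundled; here they enter as the typed Theorem 5.7 (root level,
witnesses exposed) `ThetaFrobenioid.RootTransportWith Ψ α β e D_c D_p` of `FrobenioidRootTransport.lean` —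
and the §5 named inputs enter as abc-iut-L2-t4's bundle `ThetaFrobenioid.Facts` (`FrobenioidMonoTheta.lean`)
with Lemma 5.9 (iii) (`OuterActionLZ`) DISCHARGED by the proved `outerActionLZ_of` instead of assumed.
Remaining hypotheses are exactly the cited inputs from OUTSIDE §5's own statements: a faithful 1-compatible
`Ψ^bs` (Thm. 4.4 (i)), the birational square and `Ψ^birat_Aut(K^×) = K^×` (Prop. 3.4 (ii); [FrdI] Prop. 4.4),
the transport of `s^trv_N` over a base automorphism `θ` preserving `Im(Π^tp_Y̲)`, `H_{B_N}` (Thm. 4.4 (iv);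
[FrdI] Prop. 5.6; Prop. 2.4), and for (iii) a representative `ψY` of the automorphisms of `Π^tp_X̲` induced by
`Ψ^bs`.  HONEST FRAMING: kernel-checked implications between typed statements about the §5 data; nothing of
[EtTh] is asserted unconditionally; typed ≠ discharged; no side is taken on anything downstream. -/

namespace Literature.AnabelianGeometry.EtaleTheta

open CategoryTheory
open scoped Pointwise

universe w v v' u u'

namespace ThetaFrobenioid

variable {C : Type u} [Category.{v} C] {D : Type u'} [Category.{v'} D] {𝔉 : ThetaFrobenioid.{w} C D}

/-- **[EtTh] Theorem 5.10 (ii) from Theorem 5.7 (root level, by name).**  abc-iut-L2-d4's `psiAutPreserves_of`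
with its root-transport clauses supplied by `RootTransportWith Ψ α β e D_c D_p` and Lemma 5.9 (iii)
(`OuterActionLZ`) supplied by the proved `outerActionLZ_of`; the other hypotheses are d4's, verbatim.
[cite: MochizukiEtTh2009, Thm 5.10 (ii) p.333–335 (PDF pp.107–109); Thm 5.7 p.329–330 (PDF pp.103–104)] -/
theorem psiAutPreserves_of_rootTransportWith (Ψ : C ≌ C) (β : Ψ.functor.obj 𝔉.BN ≅ 𝔉.BN)
    [Epi 𝔉.sCap] [Epi 𝔉.sCup] (hcap : 𝔉.SgpCapSpec) (hcup : 𝔉.SgpCupSpec)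
    (hsec : 𝔉.SgpCapSection) (h8 : 𝔉.ConstantsEqNormalizer)
    (ΨbiratAut : 𝔉.biratUnits 𝔉.BN ≃* 𝔉.biratUnits 𝔉.BN)
    (Ψbs : D ⥤ D) [Ψbs.Faithful] (eΨ : Ψ.functor ⋙ 𝔉.base ≅ 𝔉.base ⋙ Ψbs)
    (hsq : ∀ u : 𝔉.units 𝔉.BN, ∀ hu : 𝔉.psiAut Ψ β u ∈ 𝔉.units 𝔉.BN,
      ΨbiratAut (𝔉.unitsToBirat 𝔉.BN u) = 𝔉.unitsToBirat 𝔉.BN ⟨_, hu⟩)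
    (hconst : 𝔉.constEmb.range.map ΨbiratAut.toMonoidHom = 𝔉.constEmb.range)
    (α : Ψ.functor.obj 𝔉.AN ≅ 𝔉.AN) (e : 𝔉.AN ≅ 𝔉.AN) (Dc Dp : Aut 𝔉.BN)
    (hRT : 𝔉.RootTransportWith Ψ α β e Dc Dp)
    (θ : Aut (𝔉.base.obj 𝔉.BN) ≃* Aut (𝔉.base.obj 𝔉.BN))
    (hstrv : ∀ g : Aut (𝔉.base.obj 𝔉.BN),
      α.inv ≫ Ψ.functor.map (𝔉.strv (𝔉.autBaseIsoAB.symm g)).hom ≫ α.hom ≫ e.hom =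
        e.hom ≫ (𝔉.strv (𝔉.autBaseIsoAB.symm (θ g))).hom)
    (hY : 𝔉.imPiY.map θ.toMonoidHom = 𝔉.imPiY) (hYdd : 𝔉.HB.map θ.toMonoidHom = 𝔉.HB) :
    𝔉.PsiAutPreserves Ψ β ΨbiratAut :=
  psiAutPreserves_of Ψ β hcap hcup hsec 𝔉.outerActionLZ_of h8 ΨbiratAut Ψbs eΨ hsq hconst α e Dc Dp θ
    hRT.1 hRT.2.1 hRT.2.2 hstrv hY hYdd

/-- **[EtTh] Theorem 5.10 (ii) from Theorem 5.7 and the bundled §5 facts.**  Same, with the §5 named inputs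
(`SgpCapSpec`, `SgpCupSpec`, `Epi s^⊓_N, s^⊔_N`, hence `SgpCapSection`, `ConstantsEqNormalizer` = Lemma 5.8)
read off abc-iut-L2-t4's `Facts` bundle.
[cite: MochizukiEtTh2009, Thm 5.10 (ii) p.333–335 (PDF pp.107–109); Thm 5.7 p.329–330 (PDF pp.103–104)] -/
theorem Facts.psiAutPreserves_of_rootTransportWith (H : 𝔉.Facts) (Ψ : C ≌ C)
    (β : Ψ.functor.obj 𝔉.BN ≅ 𝔉.BN) (ΨbiratAut : 𝔉.biratUnits 𝔉.BN ≃* 𝔉.biratUnits 𝔉.BN)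
    (Ψbs : D ⥤ D) [Ψbs.Faithful] (eΨ : Ψ.functor ⋙ 𝔉.base ≅ 𝔉.base ⋙ Ψbs)
    (hsq : ∀ u : 𝔉.units 𝔉.BN, ∀ hu : 𝔉.psiAut Ψ β u ∈ 𝔉.units 𝔉.BN,
      ΨbiratAut (𝔉.unitsToBirat 𝔉.BN u) = 𝔉.unitsToBirat 𝔉.BN ⟨_, hu⟩)
    (hconst : 𝔉.constEmb.range.map ΨbiratAut.toMonoidHom = 𝔉.constEmb.range)
    (α : Ψ.functor.obj 𝔉.AN ≅ 𝔉.AN) (e : 𝔉.AN ≅ 𝔉.AN) (Dc Dp : Aut 𝔉.BN)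
    (hRT : 𝔉.RootTransportWith Ψ α β e Dc Dp)
    (θ : Aut (𝔉.base.obj 𝔉.BN) ≃* Aut (𝔉.base.obj 𝔉.BN))
    (hstrv : ∀ g : Aut (𝔉.base.obj 𝔉.BN),
      α.inv ≫ Ψ.functor.map (𝔉.strv (𝔉.autBaseIsoAB.symm g)).hom ≫ α.hom ≫ e.hom =
        e.hom ≫ (𝔉.strv (𝔉.autBaseIsoAB.symm (θ g))).hom)
    (hY : 𝔉.imPiY.map θ.toMonoidHom = 𝔉.imPiY) (hYdd : 𝔉.HB.map θ.toMonoidHom = 𝔉.HB) :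
    𝔉.PsiAutPreserves Ψ β ΨbiratAut :=
  haveI := H.epi_sCap
  haveI := H.epi_sCup
  ThetaFrobenioid.psiAutPreserves_of_rootTransportWith Ψ β H.sgpCapSpec H.sgpCupSpec H.sgpCapSection
    H.constantsEqNormalizer ΨbiratAut Ψbs eΨ hsq hconst α e Dc Dp hRT θ hstrv hY hYdd

/-- **[EtTh] Theorem 5.10 (ii) and (iii) from Theorem 5.7 and the bundled §5 facts** — abc-iut-L2-d4's
assembly `thm510_ii_iii_of_inputs` (mono-theta environment with no extra Kummer part, `DK = ∅`) with: the
§5 named inputs taken from `Facts` (Lemma 5.9 (i) `SectionsFactor`, `SgpCapSection`, `SgpCupSection`,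
Lemma 5.8 `ConstantsEqNormalizer`, the defining relations and epimorphicity), Lemma 5.9 (iii) `OuterActionLZ`
PROVED (`outerActionLZ_of`), and Theorem 5.7 entering as `RootTransportWith Ψ α β e D_c D_p`.  Conclusion: the
typed statements `PsiAutPreserves Ψ β Ψ^birat_Aut` (Thm. 5.10 (ii)) and `MonoThetaEnvCompat … ∅ Ψ β ψY …`
(Thm. 5.10 (iii), v2 shape) for the Frobenioid-theoretic mono-theta environment built from `Facts`.
[cite: MochizukiEtTh2009, Thm 5.10 (ii)(iii) p.333–335 (PDF pp.107–109); Thm 5.7 p.329–330 (PDF pp.103–104)] -/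
theorem Facts.thm510_ii_iii_of_rootTransportWith (H : 𝔉.Facts) (Ψ : C ≌ C)
    (β : Ψ.functor.obj 𝔉.BN ≅ 𝔉.BN) (ΨbiratAut : 𝔉.biratUnits 𝔉.BN ≃* 𝔉.biratUnits 𝔉.BN)
    (Ψbs : D ⥤ D) [Ψbs.Faithful] (eΨ : Ψ.functor ⋙ 𝔉.base ≅ 𝔉.base ⋙ Ψbs)
    (hsq : ∀ u : 𝔉.units 𝔉.BN, ∀ hu : 𝔉.psiAut Ψ β u ∈ 𝔉.units 𝔉.BN,
      ΨbiratAut (𝔉.unitsToBirat 𝔉.BN u) = 𝔉.unitsToBirat 𝔉.BN ⟨_, hu⟩)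
    (hconst : 𝔉.constEmb.range.map ΨbiratAut.toMonoidHom = 𝔉.constEmb.range)
    (α : Ψ.functor.obj 𝔉.AN ≅ 𝔉.AN) (e : 𝔉.AN ≅ 𝔉.AN) (Dc Dp : Aut 𝔉.BN)
    (hRT : 𝔉.RootTransportWith Ψ α β e Dc Dp)
    (θ : Aut (𝔉.base.obj 𝔉.BN) ≃* Aut (𝔉.base.obj 𝔉.BN))
    (hstrv : ∀ g : Aut (𝔉.base.obj 𝔉.BN),
      α.inv ≫ Ψ.functor.map (𝔉.strv (𝔉.autBaseIsoAB.symm g)).hom ≫ α.hom ≫ e.hom =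
        e.hom ≫ (𝔉.strv (𝔉.autBaseIsoAB.symm (θ g))).hom)
    (hY : 𝔉.imPiY.map θ.toMonoidHom = 𝔉.imPiY) (hYdd : 𝔉.HB.map θ.toMonoidHom = 𝔉.HB)
    (ψY : 𝔉.PiX ≃ₜ* 𝔉.PiX)
    (hbase : ∀ g, 𝔉.autBase 𝔉.BN (𝔉.psiAut Ψ β (𝔉.sgpCap (𝔉.ρ g))) = 𝔉.ρ (ψY g))
    (hψY : 𝔉.PiY.map ψY.toMulEquiv.toMonoidHom = 𝔉.PiY)
    (hψYdd : 𝔉.PiYdd.map ψY.toMulEquiv.toMonoidHom = 𝔉.PiYdd) :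
    𝔉.PsiAutPreserves Ψ β ΨbiratAut ∧
      𝔉.MonoThetaEnvCompat H.sectionsFactor 𝔉.outerActionLZ_of H.sgpCapSection H.sgpCupSection
        H.constantsEqNormalizer ∅ Ψ β ψY hbase hψY hψYdd :=
  haveI := H.epi_sCap
  haveI := H.epi_sCup
  thm510_ii_iii_of_inputs Ψ β H.sgpCapSpec H.sgpCupSpec H.sgpCapSection H.sgpCupSection H.sectionsFactor
    𝔉.outerActionLZ_of H.constantsEqNormalizer ΨbiratAut Ψbs eΨ hsq hconst α e Dc Dp θ hRT.1 hRT.2.1 hRT.2.2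
    hstrv hY hYdd ψY hbase hψY hψYdd

/-- The mono-theta environment of the last theorem IS abc-iut-L2-t4's `monoThetaEnvOf H ∅` (the
Frobenioid-theoretic mono-theta environment of Theorem 5.10 (iii) built from the `Facts` bundle, no extra Kummer
part) — definitionally.  [cite: MochizukiEtTh2009, Thm 5.10 (iii) p.334 (PDF p.108)] -/
theorem Facts.monoThetaEnvOf_empty_eq (H : 𝔉.Facts) :
    𝔉.monoThetaEnvOf H ∅ =
      𝔉.frdMonoThetaEnv H.sectionsFactor 𝔉.outerActionLZ_of H.sgpCapSection H.sgpCupSection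
        H.constantsEqNormalizer ∅ :=
  rfl

/-! ### v2 (append-only): Theorem 4.4 (iv) cited by name as well (`StrvTransport`, FrobenioidRootTransport v3 p413142) -/

/-- **[EtTh] Theorem 5.10 (ii) from Theorem 5.7 AND Theorem 4.4 (iv), both by name**: as
`Facts.psiAutPreserves_of_rootTransportWith`, with the transport of `s^trv_N` entering as the named predicate
`StrvTransport Ψ α e θ` (Thm. 4.4 (iv) at the `N`-th root) instead of an unbundled binder.
[cite: MochizukiEtTh2009, Thm 5.10 (ii) p.333–335 (PDF pp.107–109); Thm 5.7 p.329–330 (PDF pp.103–104); Thm 4.4 (iv) p.320 (PDF p.94)] -/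
theorem Facts.psiAutPreserves_of_transports (H : 𝔉.Facts) (Ψ : C ≌ C)
    (β : Ψ.functor.obj 𝔉.BN ≅ 𝔉.BN) (ΨbiratAut : 𝔉.biratUnits 𝔉.BN ≃* 𝔉.biratUnits 𝔉.BN)
    (Ψbs : D ⥤ D) [Ψbs.Faithful] (eΨ : Ψ.functor ⋙ 𝔉.base ≅ 𝔉.base ⋙ Ψbs)
    (hsq : ∀ u : 𝔉.units 𝔉.BN, ∀ hu : 𝔉.psiAut Ψ β u ∈ 𝔉.units 𝔉.BN,
      ΨbiratAut (𝔉.unitsToBirat 𝔉.BN u) = 𝔉.unitsToBirat 𝔉.BN ⟨_, hu⟩)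
    (hconst : 𝔉.constEmb.range.map ΨbiratAut.toMonoidHom = 𝔉.constEmb.range)
    (α : Ψ.functor.obj 𝔉.AN ≅ 𝔉.AN) (e : 𝔉.AN ≅ 𝔉.AN) (Dc Dp : Aut 𝔉.BN)
    (hRT : 𝔉.RootTransportWith Ψ α β e Dc Dp)
    (θ : Aut (𝔉.base.obj 𝔉.BN) ≃* Aut (𝔉.base.obj 𝔉.BN)) (hST : 𝔉.StrvTransport Ψ α e θ)
    (hY : 𝔉.imPiY.map θ.toMonoidHom = 𝔉.imPiY) (hYdd : 𝔉.HB.map θ.toMonoidHom = 𝔉.HB) :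
    𝔉.PsiAutPreserves Ψ β ΨbiratAut :=
  H.psiAutPreserves_of_rootTransportWith Ψ β ΨbiratAut Ψbs eΨ hsq hconst α e Dc Dp hRT θ hST hY hYdd

/-- **[EtTh] Theorem 5.10 (ii) and (iii) from Theorem 5.7, Theorem 4.4 (iv) (both by name) and the bundled §5 facts**
— `Facts.thm510_ii_iii_of_rootTransportWith` with `StrvTransport`.
[cite: MochizukiEtTh2009, Thm 5.10 (ii)(iii) p.333–335 (PDF pp.107–109); Thm 4.4 (iv) p.320 (PDF p.94)] -/
theorem Facts.thm510_ii_iii_of_transports (H : 𝔉.Facts) (Ψ : C ≌ C)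
    (β : Ψ.functor.obj 𝔉.BN ≅ 𝔉.BN) (ΨbiratAut : 𝔉.biratUnits 𝔉.BN ≃* 𝔉.biratUnits 𝔉.BN)
    (Ψbs : D ⥤ D) [Ψbs.Faithful] (eΨ : Ψ.functor ⋙ 𝔉.base ≅ 𝔉.base ⋙ Ψbs)
    (hsq : ∀ u : 𝔉.units 𝔉.BN, ∀ hu : 𝔉.psiAut Ψ β u ∈ 𝔉.units 𝔉.BN,
      ΨbiratAut (𝔉.unitsToBirat 𝔉.BN u) = 𝔉.unitsToBirat 𝔉.BN ⟨_, hu⟩)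
    (hconst : 𝔉.constEmb.range.map ΨbiratAut.toMonoidHom = 𝔉.constEmb.range)
    (α : Ψ.functor.obj 𝔉.AN ≅ 𝔉.AN) (e : 𝔉.AN ≅ 𝔉.AN) (Dc Dp : Aut 𝔉.BN)
    (hRT : 𝔉.RootTransportWith Ψ α β e Dc Dp)
    (θ : Aut (𝔉.base.obj 𝔉.BN) ≃* Aut (𝔉.base.obj 𝔉.BN)) (hST : 𝔉.StrvTransport Ψ α e θ)
    (hY : 𝔉.imPiY.map θ.toMonoidHom = 𝔉.imPiY) (hYdd : 𝔉.HB.map θ.toMonoidHom = 𝔉.HB)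
    (ψY : 𝔉.PiX ≃ₜ* 𝔉.PiX)
    (hbase : ∀ g, 𝔉.autBase 𝔉.BN (𝔉.psiAut Ψ β (𝔉.sgpCap (𝔉.ρ g))) = 𝔉.ρ (ψY g))
    (hψY : 𝔉.PiY.map ψY.toMulEquiv.toMonoidHom = 𝔉.PiY)
    (hψYdd : 𝔉.PiYdd.map ψY.toMulEquiv.toMonoidHom = 𝔉.PiYdd) :
    𝔉.PsiAutPreserves Ψ β ΨbiratAut ∧
      𝔉.MonoThetaEnvCompat H.sectionsFactor 𝔉.outerActionLZ_of H.sgpCapSection H.sgpCupSection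
        H.constantsEqNormalizer ∅ Ψ β ψY hbase hψY hψYdd :=
  H.thm510_ii_iii_of_rootTransportWith Ψ β ΨbiratAut Ψbs eΨ hsq hconst α e Dc Dp hRT θ hST hY hYdd ψY hbase
    hψY hψYdd

end ThetaFrobenioid

end Literature.AnabelianGeometry.EtaleTheta
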